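import Mathlib.RingTheory.Nullstellensatz
import Mathlib.Order.Closure
import Mathlib.RingTheory.MvPolynomial.Homogeneous
import Mathlib.Analysis.Complex.Basic
import Mathlib.Topology.Constructions
import Literature.Computability.AlgebraicComplexity.LinSubst
import Literature.Computability.AlgebraicComplexity.StandardFamilies
import Literature.Computability.AlgebraicComplexity.DeterminantalComplexity
import HarnessLib

-- provenance: harness21/H21/H21/Prelude/CplxAlg/OrbitClosure.lean @ 7a08ad6 (interim HEAD d8f2665); M5 mechanical rewrite
/-!
# Orbit closures of forms and the padded permanent

Trunk `CplxAlg` (geometric complexity theory), notion `gct_orbit_closure`, part 2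
(outline C7 / D4).

For a field `k` and a finite variable type `σ`, a polynomial `f : MvPolynomial σ k` is regarded as
the point `coeffVec f = (d ↦ coeff d f)` of the (infinite-dimensional) affine coefficient space
`(σ →₀ ℕ) → k`. The *orbit closure* `orbitClosure f = Δ[f]` is the set of polynomials whose
coefficient vector lies in the Zariski closure of the image of the orbit `GL σ k · f` under linear
substitution of variables (`glOrbit`, file `LinSubst.lean`); `g` is a *degeneration* of `f` when
`g ∈ orbitClosure f`. The Zariski closure of a subset `S ⊆ ι → k` is
`zeroLocus k (vanishingIdeal k S)` (Mathlib's `Mathlib.RingTheory.Nullstellensatz`, used with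
`K = k`), packaged as a `ClosureOperator`.

The *padded permanent* `paddedPerPoly k n m = X₀₀ ^ (m - n) * per(bottom-right n × n block)` is
the degree-`m` form in the `m²` variables of the generic `m × m` matrix whose membership in
`orbitClosure (detPoly (Fin m) k)` is the GCT reformulation of "border determinantal complexity of
`per_n` is at most `m`" (`HasBorderDetRepr`, `borderDetComplexityPer`).

## Sources

* K. Mulmuley, M. Sohoni, *Geometric complexity theory I*, SIAM J. Comput. 31 (2001), §4
  (orbit closures `Δ[f]`, Prop. 4.4, §4.1 Zariski = Euclidean closure).
* P. Bürgisser, C. Ikenmeyer, G. Panova, *No occurrence obstructions in geometric complexity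
  theory*, J. AMS 32 (2019), §1–2 (padded permanent `ℓ^{m-n} per_n`, "ℓ a new variable").
* P. Bürgisser, J. M. Landsberg, L. Manivel, J. Weyman, *An overview of mathematical issues
  arising in the geometric complexity theory approach to VP ≠ VNP*, SIAM J. Comput. 40 (2011), §2.
* D. Mumford, *The red book of varieties and schemes*, I §10 (complex vs Zariski closure of
  constructible sets).

## Mathlib

Mathlib has `MvPolynomial.zeroLocus`, `MvPolynomial.vanishingIdeal` and their Galois connection
(`zeroLocus_vanishingIdeal_galoisConnection`, into `(Set _)ᵒᵈ`), `ClosureOperator`,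
`MvPolynomial.IsHomogeneous`, `Finsupp.degree`; it has no named Zariski closure operator on an
affine space `ι → k` and nothing on orbit closures, which this file supplies.

## Design

* Coordinates are *all* monomials `σ →₀ ℕ` rather than the degree-`m` ones; for `f` homogeneous
  of degree `m` this gives the same closure (`mem_orbitClosure_iff_homogeneous`) and avoids a
  dependent coordinate type (outline D4).
* `zariskiClosureOperator` is built with `ClosureOperator.mk'` directly from the three easy
  lemmas. (Mathlib's `zeroLocus_vanishingIdeal_galoisConnection` gives a closure operator on
  ideals, and its `.dual.closureOperator` would give one on `Set (ι → k)` agreeing with ours; the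
  explicit construction keeps the unfolding `zariskiClosureOperator S = zariskiClosure S` `rfl`.)
* `coeffVec f` is definitionally the `Finsupp` coercion `⇑f`; Mathlib style avoids that coercion
  for `MvPolynomial` (it goes through `coeff`), whence the named wrapper.
* Degree-`m` coordinates are spelled `{d : σ →₀ ℕ // d.degree = m}`; `IsHomogeneous` uses
  `Finsupp.weight 1 d`, which agrees by `Finsupp.degree_eq_weight_one`.
* `paddedPerPoly k n m` for `n > m`: `m - n = 0` in `ℕ` and the block is all of `Fin m`, so the
  value degenerates to `per_m` — a documented junk case; every statement assumes `n ≤ m`.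
* Because of that junk case, `HasBorderDetRepr k n m` (membership of `paddedPerPoly k n m` in
  `Δ[det_m]`) is only meaningful for `n ≤ m` and is junk-*true* for small `m`: e.g.
  `paddedPerPoly k n 1 = X₀₀ = det_1` for every `n ≥ 1`, so `HasBorderDetRepr k n 1` holds.
  Statements using `HasBorderDetRepr k n m` must therefore carry the side condition `n ≤ m`, and
  `borderDetComplexityPer k n = sInf {m | 0 < m ∧ n ≤ m ∧ HasBorderDetRepr k n m}` imposes it;
  junk value `0` if the set is empty, which does not happen for `k` infinite
  (`exists_hasBorderDetRepr`, from `paddedPerPoly_mem_orbitClosure_detPoly_of_hasDetRepr` +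
  Valiant universality; hence `le_borderDetComplexityPer : n ≤ \underline{dc}(per_n)`). The
  comparison with `dc` is given in the `sInf`-free form `borderDetComplexityPer_le_of_hasDetRepr`
  and, for `n ≥ 1`, as `borderDetComplexityPer_le` (for `n = 0` one has `dc per_0 = dc 1 = 0` via
  the empty matrix but `borderDetComplexityPer k 0 = 1`, so `0 < n` is needed).
* `MvPolynomial.IsHomogeneous.of_mem_orbitClosure` is deliberately placed in Mathlib's
  `MvPolynomial.IsHomogeneous` namespace (dot-notation extension `hf.of_mem_orbitClosure hg`).
* The topology on `ℂ` is taken from `Mathlib.Analysis.Complex.Basic` (the lightest file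
  providing the `NormedField ℂ` instance; `Mathlib.Topology.Instances.Complex` imports it).
-/

noncomputable section

open MvPolynomial

namespace Literature.Computability.AlgebraicComplexity

/-! ### Zariski closure in affine space `ι → k` -/

section Zariski

variable {k : Type*} [Field k] {ι : Type*}

/-- The Zariski closure of a subset `S` of the affine space `ι → k` over a field `k`: the common
zero set of all polynomials (in variables `ι`, coefficients `k`) vanishing on `S`, i.e.
`Z(I(S))`. Mumford, Red book I §2; Mulmuley–Sohoni 2001 §4. [cite: MulmuleySohoni2001, §4] -/
def zariskiClosure (S : Set (ι → k)) : Set (ι → k) :=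
  MvPolynomial.zeroLocus k (MvPolynomial.vanishingIdeal k S)

/-- Membership in the Zariski closure: `x ∈ Z(I(S))` iff every polynomial vanishing on `S`
vanishes at `x`. Mumford, Red book I §2. [folklore] -/
theorem mem_zariskiClosure_iff {S : Set (ι → k)} {x : ι → k} :
    x ∈ zariskiClosure S ↔ ∀ p : MvPolynomial ι k, (∀ y ∈ S, aeval y p = 0) → aeval x p = 0 :=
  Iff.rfl

/-- `S ⊆ Z(I(S))` (Mathlib's `zeroLocus_vanishingIdeal_le`). Mumford, Red book I §2. [folklore] -/
theorem subset_zariskiClosure (S : Set (ι → k)) : S ⊆ zariskiClosure S :=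
  MvPolynomial.zeroLocus_vanishingIdeal_le S

/-- Zariski closure is monotone. Mumford, Red book I §2. [folklore] -/
theorem zariskiClosure_mono {S T : Set (ι → k)} (h : S ⊆ T) :
    zariskiClosure S ⊆ zariskiClosure T :=
  MvPolynomial.zeroLocus_anti_mono (MvPolynomial.vanishingIdeal_anti_mono h)

/-- Zariski closure is idempotent. Mumford, Red book I §2. [folklore] -/
theorem zariskiClosure_zariskiClosure (S : Set (ι → k)) :
    zariskiClosure (zariskiClosure S) = zariskiClosure S :=
  Set.Subset.antisymm
    (MvPolynomial.zeroLocus_anti_mono (MvPolynomial.le_vanishingIdeal_zeroLocus _))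
    (subset_zariskiClosure _)

/-- The Zariski closure as a `ClosureOperator` on `Set (ι → k)`, built directly from
`subset_zariskiClosure`, `zariskiClosure_mono`, `zariskiClosure_zariskiClosure`.
Mumford, Red book I §2. [folklore] -/
def zariskiClosureOperator : ClosureOperator (Set (ι → k)) :=
  ClosureOperator.mk' zariskiClosure (fun _ _ h => zariskiClosure_mono h) subset_zariskiClosure
    fun S => (zariskiClosure_zariskiClosure S).le

/-- `zariskiClosureOperator S = zariskiClosure S` (unfolding lemma; Mumford, Red book I §2). [folklore] -/
@[simp]
theorem zariskiClosureOperator_apply (S : Set (ι → k)) :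
    zariskiClosureOperator S = zariskiClosure S :=
  rfl

end Zariski

/-! ### Coefficient vectors and orbit closures -/

section Orbit

variable {k : Type*} [Field k] {σ : Type*}

/-- The coefficient vector of a polynomial: the point `d ↦ coeff d f` of the affine coefficient
space `(σ →₀ ℕ) → k`. Mulmuley–Sohoni 2001 §4 (a form as a point of `V = Sym^m`). [cite: MulmuleySohoni2001, §4 (a form as a point of  V = Sym^m] -/
def coeffVec (f : MvPolynomial σ k) : (σ →₀ ℕ) → k := fun d => coeff d f

/-- Unfolding lemma for `coeffVec` (Mulmuley–Sohoni 2001 §4). [cite: MulmuleySohoni2001, §4] -/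
@[simp]
theorem coeffVec_apply (f : MvPolynomial σ k) (d : σ →₀ ℕ) : coeffVec f d = coeff d f := rfl

/-- A polynomial is determined by its coefficient vector. Mulmuley–Sohoni 2001 §4. [cite: MulmuleySohoni2001, §4] -/
theorem coeffVec_injective : Function.Injective (coeffVec : MvPolynomial σ k → (σ →₀ ℕ) → k) :=
  fun f g h => MvPolynomial.ext f g fun d => congr_fun h d

variable [Fintype σ] [DecidableEq σ]

/-- The *orbit closure* `Δ[f] = \overline{GL · f}` of a polynomial `f`: all `g` whose coefficient
vector lies in the Zariski closure of the coefficient vectors of the orbit `glOrbit σ k f` under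
linear substitution of variables. Mulmuley–Sohoni 2001 §4; Bürgisser–Ikenmeyer–Panova 2019 §2. [cite: MulmuleySohoni2001, §4] -/
def orbitClosure (f : MvPolynomial σ k) : Set (MvPolynomial σ k) :=
  {g | coeffVec g ∈ zariskiClosure (coeffVec '' glOrbit σ k f)}

/-- `IsDegenerationOf g f`: `g` is a *degeneration* of `f`, i.e. `g ∈ Δ[f] = \overline{GL · f}`.
Mulmuley–Sohoni 2001 §4; Landsberg 2017 §6. [cite: MulmuleySohoni2001, §4] -/
def IsDegenerationOf (g f : MvPolynomial σ k) : Prop :=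
  g ∈ orbitClosure f

/-- Membership in the orbit closure, unfolded: every polynomial in the coefficients vanishing on
the orbit `GL · f` vanishes at `g`. Mulmuley–Sohoni 2001 §4. [cite: MulmuleySohoni2001, §4] -/
theorem mem_orbitClosure_iff {f g : MvPolynomial σ k} :
    g ∈ orbitClosure f ↔ ∀ p : MvPolynomial (σ →₀ ℕ) k,
      (∀ h ∈ glOrbit σ k f, aeval (coeffVec h) p = 0) → aeval (coeffVec g) p = 0 := by
  simp only [orbitClosure, Set.mem_setOf_eq, mem_zariskiClosure_iff, Set.forall_mem_image]

/-- The orbit is contained in its closure: `GL · f ⊆ Δ[f]`. Mulmuley–Sohoni 2001 §4. [cite: MulmuleySohoni2001, §4] -/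
theorem glOrbit_subset_orbitClosure (f : MvPolynomial σ k) : glOrbit σ k f ⊆ orbitClosure f :=
  fun _ hg => subset_zariskiClosure _ (Set.mem_image_of_mem _ hg)

/-- `f ∈ Δ[f]`. Mulmuley–Sohoni 2001 §4. [cite: MulmuleySohoni2001, §4] -/
theorem mem_orbitClosure_self (f : MvPolynomial σ k) : f ∈ orbitClosure f :=
  glOrbit_subset_orbitClosure f (mem_glOrbit_self f)

/-- Over an infinite field the endomorphism orbit `End(k^σ) · f` lies in the orbit closure:
`GL σ k` is Zariski dense in all matrices, and `A ↦ coeffVec (A · f)` is polynomial in `A`.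
Mulmuley–Sohoni 2001 §4; Landsberg 2017 §6. The density lemma the proof needs is exactly
Mathlib's `MvPolynomial.eq_of_eval_eq_on_gl`
(`Mathlib.LinearAlgebra.Matrix.GeneralLinearGroup.MvPolynomial`, to be imported when the proof
is filled in). False over finite fields, whence `[Infinite k]`. [cite: MulmuleySohoni2001, §4] -/
def endOrbit_subset_orbitClosure : Prop :=
  ∀ [Infinite k] (f : MvPolynomial σ k),
    endOrbit σ k f ⊆ orbitClosure f

/-- Orbit closures are transitive: if `g ∈ Δ[f]` then `Δ[g] ⊆ Δ[f]` (the action of each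
`A ∈ GL` on coefficient vectors is polynomial, hence Zariski continuous).
Mulmuley–Sohoni 2001 §4. [cite: MulmuleySohoni2001, §4] -/
def orbitClosure_subset_of_mem : Prop :=
  ∀ {f g : MvPolynomial σ k} (h : g ∈ orbitClosure f),
    orbitClosure g ⊆ orbitClosure f

/-- Every degeneration of a form of degree `m` is a form of degree `m`: the coordinate functions
`coeff d`, `d.degree ≠ m`, vanish on `GL · f`. Mulmuley–Sohoni 2001 §4.
(Deliberate dot-notation extension of Mathlib's `MvPolynomial.IsHomogeneous`.) [cite: MulmuleySohoni2001, §4. (Deliberate dot-notation extension o] -/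
protected theorem _root_.MvPolynomial.IsHomogeneous.of_mem_orbitClosure
    {f g : MvPolynomial σ k} {m : ℕ}
    (hf : f.IsHomogeneous m) (hg : g ∈ orbitClosure f) : g.IsHomogeneous m := by
  rw [mem_orbitClosure_iff] at hg
  intro d hd
  by_contra hne
  apply hd
  have := hg (X d) fun h hh => by
    obtain ⟨A, rfl⟩ := hh
    rw [aeval_X]
    have hh : (linSubstRep σ k A f).IsHomogeneous m := by
      rw [linSubstRep_apply]; exact linSubst_isHomogeneous _ hf
    by_contra hc
    exact hne (hh hc)
  simpa using this

/-- For `f` homogeneous of degree `m`, the orbit closure may be computed with test polynomials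
in the degree-`m` coordinates only: `g ∈ Δ[f]` iff `g` is homogeneous of degree `m` and every
polynomial in the variables `{d // d.degree = m}` vanishing on (the degree-`m` coefficients of)
`GL · f` vanishes at `g` (outline D4; Mulmuley–Sohoni 2001 §4, `V = Sym^m`). [cite: MulmuleySohoni2001, §4   V = Sym^m] -/
def mem_orbitClosure_iff_homogeneous : Prop :=
  ∀ {f g : MvPolynomial σ k} {m : ℕ} (hf : f.IsHomogeneous m),
    g ∈ orbitClosure f ↔ g.IsHomogeneous m ∧
      ∀ p : MvPolynomial {d : σ →₀ ℕ // d.degree = m} k,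
        (∀ h ∈ glOrbit σ k f, aeval (fun d => coeffVec h d.1) p = 0) →
          aeval (fun d => coeffVec g d.1) p = 0

end Orbit

/-! ### The padded permanent and border determinantal complexity -/

section Padded

variable (k : Type*) [Field k]

/-- The index type `{i : Fin m // m - n ≤ i}` of the bottom-right `n × n` block of an `m × m`
matrix (for `n ≤ m` it has `n` elements, `card_blockIdx`; for `n > m` it is all of `Fin m`,
which makes `paddedPerPoly k n m = per_m` and `HasBorderDetRepr k n m` junk — e.g. junk-true for
`m = 1 ≤ n` since `per_1 = det_1`; see `borderDetComplexityPer`).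
Bürgisser–Ikenmeyer–Panova 2019 §1 (`per_n` placed in a corner of the `m × m` matrix). [cite: BurgisserIkenmeyerPanova2019, §1 ( per_n  placed in a corner of the  m] -/
abbrev BlockIdx (n m : ℕ) : Type :=
  {i : Fin m // m - n ≤ (i : ℕ)}

/-- The *padded permanent* `X₀₀ ^ (m - n) · per_n` as a degree-`m` form in the `m²` variables of
the generic `m × m` matrix: `per_n` is the permanent of the **bottom-right** `n × n` block
(row and column indices `BlockIdx n m = {i : Fin m // m - n ≤ i}`), and the padding variable is
the `(0,0)` entry, which is *not* a variable of that block whenever `n < m` ("ℓ a new variable").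
For `n = m` this is `per_m`. Junk case: for `n > m`, `m - n = 0` in `ℕ` and the block is all of
`Fin m`, so the value is `per_m`; all statements assume `n ≤ m`.
Mulmuley–Sohoni 2001 §4; Bürgisser–Ikenmeyer–Panova 2019 §1. [cite: MulmuleySohoni2001, §4] -/
def paddedPerPoly (n m : ℕ) [NeZero m] : MvPolynomial (Fin m × Fin m) k :=
  X (0, 0) ^ (m - n) *
    rename (fun ij : BlockIdx n m × BlockIdx n m => ((ij.1 : Fin m), (ij.2 : Fin m)))
      (perPoly (BlockIdx n m) k)

/-- `HasBorderDetRepr k n m`: the padded permanent `X₀₀ ^ (m - n) per_n` lies in the orbit closure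
`Δ[det_m] = \overline{GL_{m²} · det_m}`; for `n ≤ m` this says that the border determinantal
complexity of `per_n` is at most `m`. **Junk for `m < n`** (then `paddedPerPoly k n m = per_m`; in
particular `HasBorderDetRepr k n 1` is *true* for every `n ≥ 1` as `per_1 = X₀₀ = det_1`), so every
statement using it carries the side condition `n ≤ m` (as `borderDetComplexityPer` does).
Mulmuley–Sohoni 2001 §4 (Conj. 4.3); Bürgisser–Ikenmeyer–Panova 2019 §1. [cite: MulmuleySohoni2001, §4 (Conj. 4.3] -/
def HasBorderDetRepr (n m : ℕ) [NeZero m] : Prop :=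
  paddedPerPoly k n m ∈ orbitClosure (detPoly (Fin m) k)

/-- The *border determinantal complexity* `\underline{dc}(per_n)` of the `n × n` permanent: the
least `m ≥ max n 1` such that `X₀₀ ^ (m - n) per_n ∈ \overline{GL_{m²} · det_m}` (the constraint
`n ≤ m` excludes the junk range of `paddedPerPoly`/`HasBorderDetRepr`; in print `m ≥ n` is
implicit since `ℓ ^ (m - n)` must make sense). Defined as an `sInf` over `ℕ`; junk value `0` iff no
such `m` exists, which does not happen over an infinite field (`exists_hasBorderDetRepr`,
`le_borderDetComplexityPer`).
Mulmuley–Sohoni 2001 §4; Bürgisser–Ikenmeyer–Panova 2019 §1; Landsberg 2017 §6. [cite: MulmuleySohoni2001, §4] -/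
def borderDetComplexityPer (n : ℕ) : ℕ :=
  sInf {m : ℕ | ∃ h : 0 < m, n ≤ m ∧ (haveI := NeZero.of_pos h; HasBorderDetRepr k n m)}

variable {k}

/-- For `n ≤ m` the index type `{i : Fin m // m - n ≤ i}` of the bottom-right block has `n`
elements (Bürgisser–Ikenmeyer–Panova 2019 §1: `per_n` in the corner of an `m × m` matrix). [cite: BurgisserIkenmeyerPanova2019, §1:  per_n  in the corner of an  m × m] -/
theorem card_blockIdx {n m : ℕ} (h : n ≤ m) : Fintype.card (BlockIdx n m) = n := by
  rw [Fintype.card_subtype]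
  have : (Finset.univ.filter fun i : Fin m => m - n ≤ (i : ℕ)) =
      (Finset.univ.filter fun j : Fin m => (j : ℕ) < n).map
        ⟨fun j => Fin.rev j, Fin.rev_injective⟩ := by
    ext i
    simp only [Finset.mem_filter, Finset.mem_univ, true_and, Finset.mem_map,
      Function.Embedding.coeFn_mk]
    constructor
    · intro hi
      refine ⟨i.rev, ?_, Fin.rev_rev i⟩
      rw [Fin.val_rev]; omega
    · rintro ⟨j, hj, rfl⟩
      rw [Fin.val_rev]; omega
  rw [this, Finset.card_map, Fin.card_filter_val_lt]
  omega

/-- For `n ≤ m` the padded permanent `X₀₀ ^ (m - n) per_n` is homogeneous of degree `m`.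
Bürgisser–Ikenmeyer–Panova 2019 §1. [cite: BurgisserIkenmeyerPanova2019, §1] -/
theorem paddedPerPoly_isHomogeneous {n m : ℕ} [NeZero m] (h : n ≤ m) :
    (paddedPerPoly k n m).IsHomogeneous m := by
  have h1 := isHomogeneous_X_pow (R := k) ((0 : Fin m), (0 : Fin m)) (m - n)
  have h2 := (perPoly_isHomogeneous (n := BlockIdx n m) (k := k)).rename_isHomogeneous
    (f := fun ij : BlockIdx n m × BlockIdx n m => ((ij.1 : Fin m), (ij.2 : Fin m)))
  rw [card_blockIdx h] at h2
  have := h1.mul h2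
  rwa [Nat.sub_add_cancel h] at this

/-- Mulmuley–Sohoni 2001, Prop. 4.4 (see also Bürgisser–Landsberg–Manivel–Weyman 2011 §2):
over an infinite field, an affine determinantal representation `per_n = det (A₀ + A₁(x))` of size
`m ≥ n` yields `X₀₀ ^ (m - n) per_n ∈ \overline{GL_{m²} · det_m}`: homogenise the affine entries
on the block variables with the fresh variable `X₀₀` to obtain a (possibly singular) linear
substitution, i.e. a point of `endOrbit (det_m)`, and use `endOrbit_subset_orbitClosure`. [cite: BurgisserLandsbergManivelWeyman2011, §2] -/
def paddedPerPoly_mem_orbitClosure_detPoly_of_hasDetRepr : Prop :=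
  ∀ [Infinite k] {n m : ℕ} [NeZero m] (h : HasDetRepr (perPoly (Fin n) k) m) (hnm : n ≤ m),
    paddedPerPoly k n m ∈ orbitClosure (detPoly (Fin m) k)

/-- `sInf`-free comparison with determinantal complexity: over an infinite field, an affine
determinantal representation of `per_n` of size `m ≥ n`, `m ≥ 1`, gives
`\underline{dc}(per_n) ≤ m` (Mulmuley–Sohoni 2001 Prop. 4.4; Landsberg 2017 §6). [cite: MulmuleySohoni2001, Prop. 4.4] -/
def borderDetComplexityPer_le_of_hasDetRepr : Prop :=
  ∀ [Infinite k] {n m : ℕ} [NeZero m] (h : HasDetRepr (perPoly (Fin n) k) m) (hnm : n ≤ m),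
    borderDetComplexityPer k n ≤ m

/- interim proof relied on results that are now named facts (D-0014); demoted to a fact by the M5 import, proof preserved:
:=
  Nat.sInf_le ⟨Nat.pos_of_ne_zero (NeZero.ne m), hnm,
    paddedPerPoly_mem_orbitClosure_detPoly_of_hasDetRepr h hnm⟩
-/

/-- Over an infinite field the set defining `borderDetComplexityPer k n` is nonempty, so the
`sInf` is not the junk value `0`: take any affine determinantal representation of `per_n`
(Valiant universality, `exists_hasDetRepr`), pad it to size `≥ max n 1` (`HasDetRepr.mono`) and
apply Mulmuley–Sohoni 2001 Prop. 4.4 (`paddedPerPoly_mem_orbitClosure_detPoly_of_hasDetRepr`). [cite: MulmuleySohoni2001, Prop. 4.4 ( paddedPerPoly_mem_orbitClosu] -/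
def exists_hasBorderDetRepr : Prop :=
  ∀ [Infinite k] (n : ℕ),
    ∃ m : ℕ, ∃ h : 0 < m, n ≤ m ∧ (haveI := NeZero.of_pos h; HasBorderDetRepr k n m)

/- interim proof relied on results that are now named facts (D-0014); demoted to a fact by the M5 import, proof preserved:
:= by
  obtain ⟨m, hm⟩ := exists_hasDetRepr (perPoly (Fin n) k)
  refine ⟨max m (n + 1), by omega, by omega, ?_⟩
  haveI : NeZero (max m (n + 1)) := NeZero.of_pos (by omega)
  exact paddedPerPoly_mem_orbitClosure_detPoly_of_hasDetRepr (hm.mono (le_max_left _ _))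
    (by omega)
-/

/-- Over an infinite field, `n ≤ \underline{dc}(per_n)` and `1 ≤ \underline{dc}(per_n)`: the
defining set of `borderDetComplexityPer k n` is nonempty (`exists_hasBorderDetRepr`) and each of
its elements is `≥ max n 1` by definition. Mulmuley–Sohoni 2001 §4; Landsberg 2017 §6. [cite: MulmuleySohoni2001, §4] -/
def max_le_borderDetComplexityPer : Prop :=
  ∀ [Infinite k] (n : ℕ),
    max n 1 ≤ borderDetComplexityPer k n

/- interim proof relied on results that are now named facts (D-0014); demoted to a fact by the M5 import, proof preserved:
:= by
  obtain ⟨hpos, hle, -⟩ := Nat.sInf_mem (exists_hasBorderDetRepr (k := k) n)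
  exact max_le hle hpos
-/

/-- Over an infinite field, `n ≤ \underline{dc}(per_n)` (from `max_le_borderDetComplexityPer`).
Mulmuley–Sohoni 2001 §4. [cite: MulmuleySohoni2001, §4] -/
def le_borderDetComplexityPer : Prop :=
  ∀ [Infinite k] (n : ℕ),
    n ≤ borderDetComplexityPer k n

/- interim proof relied on results that are now named facts (D-0014); demoted to a fact by the M5 import, proof preserved:
:=
  le_of_max_le_left (max_le_borderDetComplexityPer n)
-/

/-- Border determinantal complexity is at most determinantal complexity:
`\underline{dc}(per_n) ≤ dc(per_n)` for `n ≥ 1` over an infinite field (Mulmuley–Sohoni 2001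
Prop. 4.4; Landsberg 2017 §6). The hypothesis `0 < n` is necessary: `per_0 = 1 = det` of the
empty matrix, so `dc(per_0) = 0`, whereas `borderDetComplexityPer k 0 = 1`. For `n ≥ 1` one has
`n = totalDegree per_n ≤ dc(per_n)` (`totalDegree_perPoly`,
`totalDegree_le_determinantalComplexity`), so the padding exponent is meaningful. [cite: MulmuleySohoni2001, Prop. 4.4] -/
def borderDetComplexityPer_le : Prop :=
  ∀ [Infinite k] {n : ℕ} (hn : 0 < n),
    borderDetComplexityPer k n ≤ determinantalComplexity (perPoly (Fin n) k)

/- interim proof relied on results that are now named facts (D-0014); demoted to a fact by the M5 import, proof preserved: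
:= by
  have hle : n ≤ determinantalComplexity (perPoly (Fin n) k) := by
    simpa [totalDegree_perPoly] using totalDegree_le_determinantalComplexity (perPoly (Fin n) k)
  haveI : NeZero (determinantalComplexity (perPoly (Fin n) k)) := NeZero.of_pos (by omega)
  exact borderDetComplexityPer_le_of_hasDetRepr (hasDetRepr_determinantalComplexity _) hle
-/

end Padded

/-! ### Zariski versus Euclidean closure over `ℂ` -/

section Complex

variable {σ : Type*} [Fintype σ] [DecidableEq σ]

/-- Over `ℂ`, for a form `f` of degree `m`, the Zariski orbit closure `Δ[f]` agrees with the
Euclidean closure of the orbit: the image of `orbitClosure f` under restriction of the coefficient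
vector to the degree-`m` monomials equals the closure, in the product topology on
`{d : σ →₀ ℕ // d.degree = m} → ℂ`, of the image of `glOrbit σ ℂ f` (an orbit of a connected
algebraic group is constructible, and constructible sets have equal Zariski and classical
closures). Mumford, Red book I §10 Cor. 1; Mulmuley–Sohoni 2001 §4.1. [cite: MulmuleySohoni2001, §4.1] -/
def orbitClosure_eq_euclidean_closure_complex : Prop :=
  ∀ {f : MvPolynomial σ ℂ} {m : ℕ} (hf : f.IsHomogeneous m),
    (fun g (d : {d : σ →₀ ℕ // d.degree = m}) => coeffVec g d.1) '' orbitClosure f =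
      closure ((fun g (d : {d : σ →₀ ℕ // d.degree = m}) => coeffVec g d.1) '' glOrbit σ ℂ f)

end Complex

end Literature.Computability.AlgebraicComplexity
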